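import Literature.Probability.Percolation.TriBallDisc
import Literature.Probability.Percolation.ArmPatternsFourArm
import HarnessLib

/-!
# The adjacent four-arm event in CYCLIC-ORDER form, and the planarity lemmas that type arm families

Topic `Literature/Probability/Percolation`; family `crit-perc`. Definitions with bodies and proofs
only (no named fact). Serves the named fact `Literature.Probability.Percolation.Werner2009_lemma63`
(Werner 2009, Lecture 6, Lemma 6.3 for the tree's ORDER-FREE `π̂_t`), whose remaining input after
`AltFourArmStability.lean` is Nolin's Thm. 27 [arXiv 0711.4948: Thm. 26] for the four-arm event
with the ADJACENT colour arrangement `BBWW` (P. Nolin, *Near-critical percolation in two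
dimensions*, EJP 13 (2008), §4.1: "`σ = σ₁ … σ_j` in counterclockwise order … the two sequences
`BWBW` and `WBWB` are the same, but they are different from `BBWW`"). Nolin's events `A_{j,σ}` are
defined through the CYCLIC ORDER of the arms, which on the lattice is the order of their outer
extremities along `∂Λ_R`; the tree records the alternating arrangement in cluster form
(`altFourArm`, hereditary under restriction of the arms to sub-annuli) and the adjacent one in
"joined" form (`adjFourArm`, NOT hereditary). The proof of Thm. 27 restricts arm families to inner
and outer sub-annuli ("by quasi-multiplicativity … `A_{j,σ}(2^{k₀}, 2^l)`"), so it needs the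
arrangement in a hereditary-enough form together with the planarity facts relating the forms.
This file supplies them, on top of the disc lemma `triBall_not_interleaved` (`TriBallDisc.lean`,
Bollobás–Riordan 2006, Ch. 7, Lemma 5 for the hexagon `Λ_R`):

* `HexBtw`, `HexSep` — "strictly between" and "`{a, b}` separates `{c, d}`" for perimeter
  coordinates (`hexPos`), with the symmetry `hexSep_symm`;
* `not_hexSep_of_paths` — **four boundary sites joined in pairs by a path of `Λ_R ∩ B` and a path
  of `Λ_R ∖ B` are not interleaved** (the eight cyclic instances of `triBall_not_interleaved`);
* `adjFourArmCyc r R` — **Nolin's `A_{4,BBWW}(r, R)`**: four pairwise disjoint arms across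
  `{r ≤ |·|_𝕋 ≤ R}`, open, closed, open, closed, whose closed outer extremities do NOT separate the
  open ones on `∂Λ_R`; `adjFourArmCyc_subset_armEvent`, `adjFourArmCyc_determined`,
  `determinedBy_adjFourArmCyc`, `measurableSet_adjFourArmCyc`, `compl_preimage_adjFourArmCyc`;
* `not_pathIn_of_hexSep` — **interleaved arms separate**: if the outer extremities of two of four
  pairwise disjoint arms separate those of the other two, no path of the annulus off the first two
  joins the other two (hole trick: the separating pair is joined through the hole `Λ_{r-1}`);
* `mem_altFourArm_of_hexSep`, `armEvent_four_eq_altFourArm_union_adjFourArmCyc`,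
  `adjFourArm_subset_adjFourArmCyc` — an interleaved family is alternating in cluster form; the
  order-free event is the union of the two arrangements; joined families are cyclically adjacent;
* `hexSector`, `pathIn_hexSector_to_hub`, `disjoint_hexSector_zero_three`,
  `exists_adj_mem_hexSide_pred` — the arcs "sides `i`, `i+1`" of `∂Λ_K`, their connectedness and
  the inward step from side `i` of `∂Λ_{K+1}` to side `i` of `∂Λ_K`;
* `not_hexSep_of_innerLanded` — **arms landed on the INNER sides `0 ∪ 1` (open) and `3 ∪ 4`
  (closed) have cyclically adjacent OUTER extremities** (both pairs are joined through the hole,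
  inside the two disjoint arcs of `∂Λ_{r-1}`), whence `mem_adjFourArmCyc_of_innerLanded`;
* `hexPos_bounds_of_mem_hexSide`, `not_hexSep_of_outerLanded`, `mem_adjFourArmCyc_of_outerLanded`
  — arms landed on the OUTER sides `0 ∪ 1` / `3 ∪ 4` are cyclically adjacent (positions only).

The last two items are what makes the inner and the outer pieces of a doubly-landed adjacent arm
family (the host event of the adjacent Thm. 27) lie in `adjFourArmCyc` of their sub-annuli with no
further topology.

## References

* P. Nolin, Near-critical percolation in two dimensions, *Electron. J. Probab.* 13 (2008), §4.1
  (colour sequences in counterclockwise order; `BWBW ≠ BBWW`), §4.2 (landing sequences), §6.2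
  proof of Thm. 27 [arXiv 0711.4948: Thm. 26] [Nolin2008].
* B. Bollobás, O. Riordan, *Percolation*, Cambridge University Press (2006), Ch. 7, Lemma 5
  p. 169 ("but not both") [BollobasRiordan2006].
* S. Smirnov, W. Werner, Critical exponents for two-dimensional percolation, *Math. Res. Lett.* 8
  (2001), §4 (`H_j` versus prescribed cyclic order) [SmirnovWernerMRL2001].

## Mathlib / tree

Tree: `hexPos`, `hexPos_rot_side0`, `hexPos_injOn`, `hexPos_range`, `triBall_not_interleaved`,
`exists_rot_side0`, `rot_adj_iff`, `triNorm_side0`, `triRot60_corner` (`TriBallDisc.lean`);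
`hexSide`, `mem_hexSide_iff`, `mem_hexSide_zero`, `coord_of_mem_hexSide_one/three/four`,
`triNorm_of_mem_hexSide`, `pathIn_triBall`, `exists_adj_mem_triBall_sub_one` (`LandedAltFourArm.lean`);
`altFourArm`, `triAnn`, `mem_triAnn` (`AltFourArm.lean`); `adjFourArm`,
`armEvent_four_eq_alt_union_adj` (`ArmPatternsFourArm.lean`); `armEvent`, `IsColouredPath`,
`isColouredPath_compl_iff`, `vecTFTF_succ`, `mem_triAnnulus_of_arm`; `triRotIsoPow`,
`triRotIsoPow_succ_apply'`, `triNorm_rot`; `PathIn` API.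
-/

noncomputable section

open Set

namespace Literature.Probability.Percolation

open LatticeModels

/-! ### Separation of four perimeter coordinates -/

/-- `c` lies strictly between `a` and `b`. [folklore] -/
def HexBtw (a b c : ℤ) : Prop := (a < c ∧ c < b) ∨ (b < c ∧ c < a)

/-- **`{a, b}` separates `{c, d}`** (for four distinct points of a circle read in a linear
coordinate): exactly one of `c`, `d` lies strictly between `a` and `b`. For the perimeter
coordinates of the outer extremities of four arms this is "the arms `a, b` and the arms `c, d`
are interleaved", i.e. the cyclic colour order is alternating (Nolin 2008, §4.1). [cite: Nolin2008, §4.1 (cyclic order of the colour sequence)] -/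
def HexSep (a b c d : ℤ) : Prop := (HexBtw a b c ∧ ¬ HexBtw a b d) ∨ (HexBtw a b d ∧ ¬ HexBtw a b c)

/-- Separation is symmetric in the two pairs (four distinct points). [folklore] -/
theorem hexSep_symm {a b c d : ℤ} (hac : a ≠ c) (had : a ≠ d) (hbc : b ≠ c) (hbd : b ≠ d)
    (h : HexSep a b c d) : HexSep c d a b := by
  unfold HexSep HexBtw at h ⊢; omega

/-- Separation is symmetric within the first pair. [folklore] -/
theorem hexSep_comm_left {a b c d : ℤ} (h : HexSep a b c d) : HexSep b a c d := by
  unfold HexSep HexBtw at h ⊢; omega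

/-- Separation is symmetric within the second pair. [folklore] -/
theorem hexSep_comm_right {a b c d : ℤ} (h : HexSep a b c d) : HexSep a b d c := by
  unfold HexSep HexBtw at h ⊢; omega

/-- The eight linear orders of four distinct separated (interleaved) points. [folklore] -/
theorem hexSep_cases {a b c d : ℤ} (hac : a ≠ c) (had : a ≠ d) (hbc : b ≠ c) (hbd : b ≠ d)
    (h : HexSep a b c d) :
    (c < a ∧ a < d ∧ d < b) ∨ (a < d ∧ d < b ∧ b < c) ∨ (d < b ∧ b < c ∧ c < a) ∨
      (b < c ∧ c < a ∧ a < d) ∨ (c < b ∧ b < d ∧ d < a) ∨ (b < d ∧ d < a ∧ a < c) ∨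
      (d < a ∧ a < c ∧ c < b) ∨ (a < c ∧ c < b ∧ b < d) := by
  rcases h with ⟨hc, hd⟩ | ⟨hd, hc⟩
  · rcases hc with ⟨h1, h2⟩ | ⟨h1, h2⟩
    · rcases lt_or_gt_of_ne had with h3 | h3
      · have : b < d := by unfold HexBtw at hd; omega
        exact Or.inr (Or.inr (Or.inr (Or.inr (Or.inr (Or.inr (Or.inr ⟨h1, h2, this⟩))))))
      · exact Or.inr (Or.inr (Or.inr (Or.inr (Or.inr (Or.inr (Or.inl ⟨h3, h1, h2⟩))))))
    · rcases lt_or_gt_of_ne hbd with h3 | h3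
      · have : a < d := by unfold HexBtw at hd; omega
        exact Or.inr (Or.inr (Or.inr (Or.inl ⟨h1, h2, this⟩)))
      · exact Or.inr (Or.inr (Or.inl ⟨h3, h1, h2⟩))
  · rcases hd with ⟨h1, h2⟩ | ⟨h1, h2⟩
    · rcases lt_or_gt_of_ne hac with h3 | h3
      · have : b < c := by unfold HexBtw at hc; omega
        exact Or.inr (Or.inl ⟨h1, h2, this⟩)
      · exact Or.inl ⟨h3, h1, h2⟩
    · rcases lt_or_gt_of_ne hbc with h3 | h3
      · have : a < c := by unfold HexBtw at hc; omega
        exact Or.inr (Or.inr (Or.inr (Or.inr (Or.inr (Or.inl ⟨h1, h2, this⟩)))))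
      · exact Or.inr (Or.inr (Or.inr (Or.inr (Or.inl ⟨h3, h1, h2⟩))))

/-- **Interleaved boundary sites cannot be joined in pairs by paths of disjoint classes** (the
eight cyclic instances of `triBall_not_interleaved`, Bollobás–Riordan's "but not both" for the
disc `Λ_R`): if `a, c ∈ ∂Λ_R` are joined by a path of `Λ_R ∩ B` and `b, d ∈ ∂Λ_R` by a path of
`Λ_R ∖ B`, then `{hexPos b, hexPos d}` does not separate `{hexPos a, hexPos c}`. [cite: BollobasRiordan2006, Ch. 7 Lemma 5 p. 169] -/
theorem not_hexSep_of_paths {R : ℕ} (hR : 1 ≤ R) (B : Set (Site 2)) {a b c d : Site 2}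
    (ha : triNorm a = R) (hb : triNorm b = R) (hc : triNorm c = R) (hd : triNorm d = R)
    (hP : PathIn triGraph ((↑(triBall R) : Set (Site 2)) ∩ B) a c)
    (hQ : PathIn triGraph ((↑(triBall R) : Set (Site 2)) ∩ Bᶜ) b d) :
    ¬ HexSep (hexPos R b) (hexPos R d) (hexPos R a) (hexPos R c) := by
  intro h
  have hab : a ≠ b := fun e => by
    have h1 := hP.left_mem.2; have h2 := hQ.left_mem.2; rw [e] at h1; exact h2 h1
  have had : a ≠ d := fun e => by
    have h1 := hP.left_mem.2; have h2 := hQ.right_mem.2; rw [e] at h1; exact h2 h1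
  have hcb : c ≠ b := fun e => by
    have h1 := hP.right_mem.2; have h2 := hQ.left_mem.2; rw [e] at h1; exact h2 h1
  have hcd : c ≠ d := fun e => by
    have h1 := hP.right_mem.2; have h2 := hQ.right_mem.2; rw [e] at h1; exact h2 h1
  have nab : hexPos R a ≠ hexPos R b := fun e => hab (hexPos_injOn hR ha hb e)
  have nad : hexPos R a ≠ hexPos R d := fun e => had (hexPos_injOn hR ha hd e)
  have ncb : hexPos R c ≠ hexPos R b := fun e => hcb (hexPos_injOn hR hc hb e)
  have ncd : hexPos R c ≠ hexPos R d := fun e => hcd (hexPos_injOn hR hc hd e)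
  have hPcc : PathIn triGraph ((↑(triBall R) : Set (Site 2)) ∩ Bᶜᶜ) a c := by
    rw [compl_compl]; exact hP
  rcases hexSep_cases nab.symm ncb.symm nad.symm ncd.symm h with h | h | h | h | h | h | h | h
  · -- a < b < c < d
    exact triBall_not_interleaved hR B ha hb hc hd h.1 h.2.1 h.2.2 hP hQ
  · -- b < c < d < a
    exact triBall_not_interleaved hR Bᶜ hb hc hd ha h.1 h.2.1 h.2.2 hQ hPcc.symm
  · -- c < d < a < b
    exact triBall_not_interleaved hR B hc hd ha hb h.1 h.2.1 h.2.2 hP.symm hQ.symm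
  · -- d < a < b < c
    exact triBall_not_interleaved hR Bᶜ hd ha hb hc h.1 h.2.1 h.2.2 hQ.symm hPcc
  · -- a < d < c < b
    exact triBall_not_interleaved hR B ha hd hc hb h.1 h.2.1 h.2.2 hP hQ.symm
  · -- d < c < b < a
    exact triBall_not_interleaved hR Bᶜ hd hc hb ha h.1 h.2.1 h.2.2 hQ.symm hPcc.symm
  · -- c < b < a < d
    exact triBall_not_interleaved hR B hc hb ha hd h.1 h.2.1 h.2.2 hP.symm hQ
  · -- b < a < d < c
    exact triBall_not_interleaved hR Bᶜ hb ha hd hc h.1 h.2.1 h.2.2 hQ hPcc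

/-! ### The adjacent four-arm event, cyclic-order form -/

/-- **Nolin's `A_{4,BBWW}(r, R)`, the four-arm event with the ADJACENT colour arrangement**: four
pairwise disjoint self-avoiding `𝕋`-paths `w 0, …, w 3` across `{r ≤ |·|_𝕋 ≤ R}` (inner
extremities on `∂Λ_r`, outer ones on `∂Λ_R`, all other sites strictly in between or on `∂Λ_r`, as
in `armEvent`), of colours open, closed, open, closed, such that on `∂Λ_R` the outer extremities
of the two closed arms do NOT separate those of the two open arms (perimeter coordinate `hexPos`):
the cyclic order of the colours is `BBWW`. (Nolin 2008, §4.1: the arms `r₁, …, r_j` "in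
counterclockwise order", `σ` up to cyclic permutation; for `j = 4` the two classes are `BWBW`
and `BBWW`.) Together with `altFourArm` it exhausts the order-free event
(`armEvent_four_eq_altFourArm_union_adjFourArmCyc`). [cite: Nolin2008, §4.1 (arXiv 0711.4948, §4.1: A_{j,σ}, colour sequences up to cyclic permutation)] -/
def adjFourArmCyc (r R : ℕ) : Set (SiteConfig (Site 2)) :=
  {ω | ∃ (x y : Fin 4 → Site 2) (w : ∀ j, triGraph.Walk (x j) (y j)),
    (∀ j, x j ∈ triSphere r ∧ y j ∈ triSphere R ∧ (w j).IsPath ∧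
      (∀ v ∈ (w j).support, v ∈ (↑(triBall R) : Set (Site 2)) \ ↑(triBall r) ∨ v ∈ triSphere r) ∧
      IsColouredPath ω (![true, false, true, false] j) (w j)) ∧
    (Pairwise fun i j => Disjoint (w i).support.toFinset (w j).support.toFinset) ∧
    ¬ HexSep (hexPos R (y 1)) (hexPos R (y 3)) (hexPos R (y 0)) (hexPos R (y 2))}

/-- The cyclically adjacent arrangement is contained in the order-free four-arm event. [cite: Nolin2008, §4.1] -/
theorem adjFourArmCyc_subset_armEvent (r R : ℕ) :
    adjFourArmCyc r R ⊆ armEvent ![true, false, true, false] r R := by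
  rintro ω ⟨x, y, w, hw, hdisj, -⟩
  exact ⟨x, y, w, hw, hdisj⟩

/-- **`adjFourArmCyc r R` is determined by the sites of the annulus** `triAnnulus r R` (the arms
lie in it; the order clause does not mention the configuration). [cite: SmirnovWernerMRL2001, §3] -/
theorem adjFourArmCyc_determined {r R : ℕ} (hrR : r ≤ R) (ω ω' : SiteConfig (Site 2))
    (h : ∀ v ∈ triAnnulus r R, (v ∈ ω ↔ v ∈ ω')) :
    ω ∈ adjFourArmCyc r R ↔ ω' ∈ adjFourArmCyc r R := by
  constructor
  · rintro ⟨x, y, w, hw, hdisj, hord⟩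
    refine ⟨x, y, w, fun j => ?_, hdisj, hord⟩
    obtain ⟨hx, hy, hpath, hsupp, hcol⟩ := hw j
    exact ⟨hx, hy, hpath, hsupp, fun v hv =>
      (h v (mem_triAnnulus_of_arm hrR (hsupp v hv))).symm.trans (hcol v hv)⟩
  · rintro ⟨x, y, w, hw, hdisj, hord⟩
    refine ⟨x, y, w, fun j => ?_, hdisj, hord⟩
    obtain ⟨hx, hy, hpath, hsupp, hcol⟩ := hw j
    exact ⟨hx, hy, hpath, hsupp, fun v hv =>
      (h v (mem_triAnnulus_of_arm hrR (hsupp v hv))).trans (hcol v hv)⟩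

/-- `DeterminedBy` form of `adjFourArmCyc_determined`. [cite: SmirnovWernerMRL2001, §3] -/
theorem determinedBy_adjFourArmCyc {r R : ℕ} (hrR : r ≤ R) :
    DeterminedBy (adjFourArmCyc r R) ↑(triAnnulus r R) := by
  rw [determinedBy_iff]
  intro ω ω' h
  refine adjFourArmCyc_determined hrR ω ω' fun v hv => ?_
  have hv' : v ∈ (↑(triAnnulus r R) : Set (Site 2)) := Finset.mem_coe.2 hv
  have key := Set.ext_iff.1 h v
  exact ⟨fun hω => (key.1 ⟨hω, hv'⟩).1, fun hω' => (key.2 ⟨hω', hv'⟩).1⟩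

/-- The cyclically adjacent four-arm event is measurable. [cite: SmirnovWernerMRL2001, §3] -/
theorem measurableSet_adjFourArmCyc {r R : ℕ} (hrR : r ≤ R) : MeasurableSet (adjFourArmCyc r R) :=
  (determinedBy_adjFourArmCyc hrR).measurableSet_of_finset

/-- The outer extremities of pairwise disjoint arms have pairwise distinct perimeter coordinates
(`R ≥ 1`). [folklore] -/
theorem hexPos_ne_of_disjoint {R : ℕ} (hR : 1 ≤ R) {x y x' y' : Site 2}
    {w : triGraph.Walk x y} {w' : triGraph.Walk x' y'} (hy : triNorm y = R) (hy' : triNorm y' = R)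
    (h : Disjoint w.support.toFinset w'.support.toFinset) : hexPos R y ≠ hexPos R y' := by
  intro e
  have hyy : y = y' := hexPos_injOn hR hy hy' e
  refine Finset.disjoint_left.1 h (List.mem_toFinset.2 w.end_mem_support) ?_
  rw [hyy]; exact List.mem_toFinset.2 w'.end_mem_support

/-- **Colour flip = cyclic relabelling** (as `compl_mem_altFourArm`): complementing the
configuration maps `adjFourArmCyc r R` (`R ≥ 1`) to itself — the arms `j ↦ w (j + 1)` of `ωᶜ` have
colours `TFTF`, and "the closed extremities do not separate the open ones" is symmetric in the
two pairs (`hexSep_symm`). [cite: Nolin2008, §4.1 (WBWB and BWBW are the same sequence)] [cite: SmirnovWernerMRL2001, Rem. 2] -/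
theorem compl_mem_adjFourArmCyc {r R : ℕ} (hR : 1 ≤ R) {ω : SiteConfig (Site 2)}
    (hω : ω ∈ adjFourArmCyc r R) : ωᶜ ∈ adjFourArmCyc r R := by
  obtain ⟨x, y, w, hw, hdisj, hord⟩ := hω
  refine ⟨fun j => x (j + 1), fun j => y (j + 1), fun j => w (j + 1), fun j => ?_, ?_, ?_⟩
  · obtain ⟨hx, hy, hpath, hsupp, hcol⟩ := hw (j + 1)
    refine ⟨hx, hy, hpath, hsupp, ?_⟩
    rw [isColouredPath_compl_iff, ← vecTFTF_succ]
    exact hcol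
  · intro i j hij
    exact hdisj fun h => hij (by simpa using h)
  · -- `¬ HexSep p₂ p₀ p₁ p₃` from `¬ HexSep p₁ p₃ p₀ p₂`
    intro h
    have hyn : ∀ j, triNorm (y j) = R := fun j => mem_triSphere_iff.1 (hw j).2.1
    have hne : ∀ i j, i ≠ j → hexPos R (y i) ≠ hexPos R (y j) := fun i j hij =>
      hexPos_ne_of_disjoint hR (hyn i) (hyn j) (hdisj hij)
    refine hord (hexSep_comm_right (hexSep_symm (hne 2 1 (by decide)) (hne 2 3 (by decide))
      (hne 0 1 (by decide)) (hne 0 3 (by decide)) ?_))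
    simpa using h

/-- `compl ⁻¹' adjFourArmCyc r R = adjFourArmCyc r R` for `R ≥ 1`. [cite: SmirnovWernerMRL2001, Rem. 2] -/
theorem compl_preimage_adjFourArmCyc {r R : ℕ} (hR : 1 ≤ R) :
    compl ⁻¹' adjFourArmCyc r R = adjFourArmCyc r R := by
  ext ω
  refine ⟨fun h => ?_, fun h => compl_mem_adjFourArmCyc hR h⟩
  have := compl_mem_adjFourArmCyc hR (ω := ωᶜ) h
  rwa [compl_compl] at this

/-! ### Interleaved arms separate (the hole trick) -/

/-- **If the outer extremities of two arms separate those of two other arms, no path of the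
annulus off the first two joins the other two.** Let `p : a ↝ a'`, `p' : c ↝ c'` and `q : b ↝ b'`,
`q' : d ↝ d'` be `𝕋`-walks with `a', b', c', d' ∈ ∂Λ_R`, `b, d ∈ ∂Λ_r` (`1 ≤ r ≤ R`), `p, p'` inside
the closed annulus `{r ≤ |·|_𝕋 ≤ R}`, `q, q'` inside `Λ_R`, and `p, p'` disjoint from `q, q'`. If
`{hexPos b', hexPos d'}` separates `{hexPos a', hexPos c'}` on `∂Λ_R`, then no path of the annulus
avoiding the sites of `q` and `q'` joins a site of `p` to a site of `p'`: such a path `γ` would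
give the path `a' → p → γ → p' → c'` of `Λ_R` off `B' = q ∪ q' ∪ Λ_{r-1}`, against the path
`b' → q → hole → q' → d'` inside `B'` (`not_hexSep_of_paths`). [cite: BollobasRiordan2006, Ch. 7 Lemma 5 p. 169] [cite: Nolin2008, §4.1 (BWBW ≠ BBWW)] -/
theorem not_pathIn_of_hexSep {r R : ℕ} (hr : 1 ≤ r) (hrR : r ≤ R)
    {a a' b b' c c' d d' : Site 2} (p : triGraph.Walk a a') (p' : triGraph.Walk c c')
    (q : triGraph.Walk b b') (q' : triGraph.Walk d d')
    (ha' : triNorm a' = R) (hb : triNorm b = r) (hb' : triNorm b' = R)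
    (hc' : triNorm c' = R) (hd : triNorm d = r) (hd' : triNorm d' = R)
    (hp : ∀ z ∈ p.support, (r : ℤ) ≤ triNorm z ∧ triNorm z ≤ R)
    (hp' : ∀ z ∈ p'.support, (r : ℤ) ≤ triNorm z ∧ triNorm z ≤ R)
    (hq : ∀ z ∈ q.support, triNorm z ≤ R) (hq' : ∀ z ∈ q'.support, triNorm z ≤ R)
    (hpq : ∀ z ∈ p.support, z ∉ q.support) (hpq' : ∀ z ∈ p.support, z ∉ q'.support)
    (hp'q : ∀ z ∈ p'.support, z ∉ q.support) (hp'q' : ∀ z ∈ p'.support, z ∉ q'.support)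
    (hsep : HexSep (hexPos R b') (hexPos R d') (hexPos R a') (hexPos R c'))
    {u v : Site 2} (hu : u ∈ p.support) (hv : v ∈ p'.support) :
    ¬ PathIn triGraph (triAnn r R \ ({z | z ∈ q.support} ∪ {z | z ∈ q'.support})) u v := by
  classical
  intro hγ
  have hR : 1 ≤ R := hr.trans hrR
  have hrR' : (r : ℤ) ≤ R := by exact_mod_cast hrR
  -- the class `B' = q ∪ q' ∪ hole`
  set B' : Set (Site 2) := {z | z ∈ q.support ∨ z ∈ q'.support ∨ triNorm z < r} with hB'
  have hball : ∀ {z : Site 2}, triNorm z ≤ R → z ∈ (↑(triBall R) : Set (Site 2)) := fun hz =>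
    Finset.mem_coe.2 (mem_triBall_iff.2 hz)
  -- the path `a' → c'` off `B'`
  have hpS : ∀ z ∈ p.support, z ∈ (↑(triBall R) : Set (Site 2)) ∩ B'ᶜ := fun z hz =>
    ⟨hball (hp z hz).2, fun h => h.elim (hpq z hz) fun h => h.elim (hpq' z hz) fun h => by
      have := (hp z hz).1; omega⟩
  have hp'S : ∀ z ∈ p'.support, z ∈ (↑(triBall R) : Set (Site 2)) ∩ B'ᶜ := fun z hz =>
    ⟨hball (hp' z hz).2, fun h => h.elim (hp'q z hz) fun h => h.elim (hp'q' z hz) fun h => by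
      have := (hp' z hz).1; omega⟩
  have hγ' : PathIn triGraph ((↑(triBall R) : Set (Site 2)) ∩ B'ᶜ) u v := by
    refine hγ.mono fun z hz => ?_
    obtain ⟨hz1, hz2⟩ := hz
    rw [mem_triAnn] at hz1
    simp only [mem_union, mem_setOf_eq, not_or] at hz2
    exact ⟨hball hz1.2, fun h => h.elim hz2.1 fun h => h.elim hz2.2 fun h => by omega⟩
  have hP : PathIn triGraph ((↑(triBall R) : Set (Site 2)) ∩ B'ᶜ) a' c' :=
    ((PathIn.of_walk_mem_support p hpS hu).2.symm.trans hγ').trans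
      (PathIn.of_walk_mem_support p' hp'S hv).2
  -- the path `b' → d'` inside `B'`, through the hole
  obtain ⟨h₁, hadj₁, hh₁⟩ := exists_adj_mem_triBall_sub_one hr hb
  obtain ⟨h₃, hadj₃, hh₃⟩ := exists_adj_mem_triBall_sub_one hr hd
  have hhole : (↑(triBall (r - 1)) : Set (Site 2)) ⊆ (↑(triBall R) : Set (Site 2)) ∩ B' := by
    intro z hz
    have hz' := mem_triBall_iff.1 (Finset.mem_coe.1 hz)
    push_cast [Nat.cast_sub hr] at hz'
    exact ⟨hball (by omega), Or.inr (Or.inr (by omega))⟩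
  have hmid : PathIn triGraph ((↑(triBall R) : Set (Site 2)) ∩ B') h₁ h₃ :=
    (pathIn_triBall hh₁ hh₃).mono hhole
  have hqS : ∀ z ∈ q.support, z ∈ (↑(triBall R) : Set (Site 2)) ∩ B' := fun z hz =>
    ⟨hball (hq z hz), Or.inl hz⟩
  have hq'S : ∀ z ∈ q'.support, z ∈ (↑(triBall R) : Set (Site 2)) ∩ B' := fun z hz =>
    ⟨hball (hq' z hz), Or.inr (Or.inl hz)⟩
  have hQ : PathIn triGraph ((↑(triBall R) : Set (Site 2)) ∩ B') b' d' :=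
    ((((PathIn.of_walk q hqS).symm.tail hadj₁ hmid.left_mem).trans hmid).trans
      (PathIn.of_adj hmid.right_mem (hq'S d q'.start_mem_support) hadj₃.symm)).trans
      (PathIn.of_walk q' hq'S)
  have hPcc : PathIn triGraph ((↑(triBall R) : Set (Site 2)) ∩ B'ᶜᶜ) b' d' := by
    rw [compl_compl]; exact hQ
  exact not_hexSep_of_paths hR B'ᶜ ha' hb' hc' hd' hP hPcc hsep

/-! ### Consequences for four-arm families -/

section Family

variable {r R : ℕ} {ω : SiteConfig (Site 2)} {x y : Fin 4 → Site 2}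
  {w : ∀ j, triGraph.Walk (x j) (y j)}

/-- Support bounds of an arm family (restatement of `mem_triAnnulus_of_arm`). [folklore] -/
theorem arm_support_bounds (hrR : r ≤ R)
    (hw : ∀ j, x j ∈ triSphere r ∧ y j ∈ triSphere R ∧ (w j).IsPath ∧
      (∀ v ∈ (w j).support, v ∈ (↑(triBall R) : Set (Site 2)) \ ↑(triBall r) ∨ v ∈ triSphere r) ∧
      IsColouredPath ω (![true, false, true, false] j) (w j))
    (j : Fin 4) : ∀ z ∈ (w j).support, (r : ℤ) ≤ triNorm z ∧ triNorm z ≤ R := fun z hz =>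
  mem_triAnnulus.1 (mem_triAnnulus_of_arm hrR ((hw j).2.2.2.1 z hz))

/-- **Interleaved arms: the open ones are not joined by an open path of the annulus.** [cite: Nolin2008, §4.1 (BWBW)] [cite: BollobasRiordan2006, Ch. 7 Lemma 5 p. 169] -/
theorem not_pathIn_open_of_hexSep (hr : 1 ≤ r) (hrR : r ≤ R)
    (hw : ∀ j, x j ∈ triSphere r ∧ y j ∈ triSphere R ∧ (w j).IsPath ∧
      (∀ v ∈ (w j).support, v ∈ (↑(triBall R) : Set (Site 2)) \ ↑(triBall r) ∨ v ∈ triSphere r) ∧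
      IsColouredPath ω (![true, false, true, false] j) (w j))
    (hdisj : Pairwise fun i j => Disjoint (w i).support.toFinset (w j).support.toFinset)
    (hsep : HexSep (hexPos R (y 1)) (hexPos R (y 3)) (hexPos R (y 0)) (hexPos R (y 2))) :
    ∀ u ∈ (w 0).support, ∀ v ∈ (w 2).support, ¬ PathIn triGraph (triAnn r R ∩ ω) u v := by
  intro u hu v hv hp
  have hb := arm_support_bounds hrR hw
  have hdj : ∀ {i j : Fin 4}, i ≠ j → ∀ z ∈ (w i).support, z ∉ (w j).support := fun hij z hz hz' =>
    Finset.disjoint_left.1 (hdisj hij) (List.mem_toFinset.2 hz) (List.mem_toFinset.2 hz')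
  refine not_pathIn_of_hexSep hr hrR (w 0) (w 2) (w 1) (w 3) (mem_triSphere_iff.1 (hw 0).2.1)
    (mem_triSphere_iff.1 (hw 1).1) (mem_triSphere_iff.1 (hw 1).2.1) (mem_triSphere_iff.1 (hw 2).2.1)
    (mem_triSphere_iff.1 (hw 3).1) (mem_triSphere_iff.1 (hw 3).2.1) (hb 0) (hb 2)
    (fun z hz => (hb 1 z hz).2) (fun z hz => (hb 3 z hz).2) (hdj (by decide)) (hdj (by decide))
    (hdj (by decide)) (hdj (by decide)) hsep hu hv (hp.mono fun z hz => ⟨hz.1, ?_⟩)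
  -- an open site is not on a closed arm
  simp only [mem_union, mem_setOf_eq, not_or]
  exact ⟨fun h => Bool.false_ne_true (((hw 1).2.2.2.2 z h).1 hz.2),
    fun h => Bool.false_ne_true (((hw 3).2.2.2.2 z h).1 hz.2)⟩

/-- **Interleaved arms: the closed ones are not joined by a closed path of the annulus.** [cite: Nolin2008, §4.1 (BWBW)] [cite: BollobasRiordan2006, Ch. 7 Lemma 5 p. 169] -/
theorem not_pathIn_closed_of_hexSep (hr : 1 ≤ r) (hrR : r ≤ R)
    (hw : ∀ j, x j ∈ triSphere r ∧ y j ∈ triSphere R ∧ (w j).IsPath ∧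
      (∀ v ∈ (w j).support, v ∈ (↑(triBall R) : Set (Site 2)) \ ↑(triBall r) ∨ v ∈ triSphere r) ∧
      IsColouredPath ω (![true, false, true, false] j) (w j))
    (hdisj : Pairwise fun i j => Disjoint (w i).support.toFinset (w j).support.toFinset)
    (hsep : HexSep (hexPos R (y 1)) (hexPos R (y 3)) (hexPos R (y 0)) (hexPos R (y 2))) :
    ∀ u ∈ (w 1).support, ∀ v ∈ (w 3).support, ¬ PathIn triGraph (triAnn r R \ ω) u v := by
  intro u hu v hv hp
  have hR : 1 ≤ R := hr.trans hrR
  have hb := arm_support_bounds hrR hw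
  have hdj : ∀ {i j : Fin 4}, i ≠ j → ∀ z ∈ (w i).support, z ∉ (w j).support := fun hij z hz hz' =>
    Finset.disjoint_left.1 (hdisj hij) (List.mem_toFinset.2 hz) (List.mem_toFinset.2 hz')
  have hyn : ∀ j, triNorm (y j) = R := fun j => mem_triSphere_iff.1 (hw j).2.1
  have hne : ∀ i j, i ≠ j → hexPos R (y i) ≠ hexPos R (y j) := fun i j hij =>
    hexPos_ne_of_disjoint hR (hyn i) (hyn j) (hdisj hij)
  have hsep' : HexSep (hexPos R (y 0)) (hexPos R (y 2)) (hexPos R (y 1)) (hexPos R (y 3)) :=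
    hexSep_symm (hne 1 0 (by decide)) (hne 1 2 (by decide)) (hne 3 0 (by decide))
      (hne 3 2 (by decide)) hsep
  refine not_pathIn_of_hexSep hr hrR (w 1) (w 3) (w 0) (w 2) (hyn 1)
    (mem_triSphere_iff.1 (hw 0).1) (hyn 0) (hyn 3) (mem_triSphere_iff.1 (hw 2).1) (hyn 2)
    (hb 1) (hb 3) (fun z hz => (hb 0 z hz).2) (fun z hz => (hb 2 z hz).2) (hdj (by decide))
    (hdj (by decide)) (hdj (by decide)) (hdj (by decide)) hsep' hu hv
    (hp.mono fun z hz => ⟨hz.1, ?_⟩)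
  -- a closed site is not on an open arm
  simp only [mem_union, mem_setOf_eq, not_or]
  exact ⟨fun h => hz.2 (((hw 0).2.2.2.2 z h).2 rfl), fun h => hz.2 (((hw 2).2.2.2.2 z h).2 rfl)⟩

/-- **An interleaved four-arm family is alternating in cluster form.** [cite: Nolin2008, §4.1 (BWBW)] [cite: KestenScalingCMP1987, §1 (1.12)] -/
theorem mem_altFourArm_of_hexSep (hr : 1 ≤ r) (hrR : r ≤ R)
    (hw : ∀ j, x j ∈ triSphere r ∧ y j ∈ triSphere R ∧ (w j).IsPath ∧
      (∀ v ∈ (w j).support, v ∈ (↑(triBall R) : Set (Site 2)) \ ↑(triBall r) ∨ v ∈ triSphere r) ∧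
      IsColouredPath ω (![true, false, true, false] j) (w j))
    (hdisj : Pairwise fun i j => Disjoint (w i).support.toFinset (w j).support.toFinset)
    (hsep : HexSep (hexPos R (y 1)) (hexPos R (y 3)) (hexPos R (y 0)) (hexPos R (y 2))) :
    ω ∈ altFourArm r R :=
  ⟨x, y, w, hw, hdisj, not_pathIn_open_of_hexSep hr hrR hw hdisj hsep,
    not_pathIn_closed_of_hexSep hr hrR hw hdisj hsep⟩

end Family

/-- **The order-free four-arm event is the union of the alternating (cluster form) and the
cyclically adjacent arrangements** (`1 ≤ r ≤ R`): a family whose closed extremities separate the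
open ones is alternating in cluster form (`mem_altFourArm_of_hexSep`), otherwise it is a family of
`adjFourArmCyc`. (Smirnov–Werner 2001, §4: `H_j` versus prescribed order; Nolin 2008, §4.1.) [cite: SmirnovWernerMRL2001, §4 (H_j(r, R))] [cite: Nolin2008, §4.1] -/
theorem armEvent_four_eq_altFourArm_union_adjFourArmCyc {r R : ℕ} (hr : 1 ≤ r) (hrR : r ≤ R) :
    armEvent ![true, false, true, false] r R = altFourArm r R ∪ adjFourArmCyc r R := by
  refine Set.Subset.antisymm ?_
    (Set.union_subset (altFourArm_subset_armEvent r R) (adjFourArmCyc_subset_armEvent r R))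
  rintro ω ⟨x, y, w, hw, hdisj⟩
  by_cases h : HexSep (hexPos R (y 1)) (hexPos R (y 3)) (hexPos R (y 0)) (hexPos R (y 2))
  · exact Or.inl (mem_altFourArm_of_hexSep hr hrR hw hdisj h)
  · exact Or.inr ⟨x, y, w, hw, hdisj, h⟩

/-- **Joined arms are cyclically adjacent**: the tree's `adjFourArm r R` (a family whose open arms
are joined by an open path of the annulus, or whose closed arms by a closed one) is contained in
`adjFourArmCyc r R` (`1 ≤ r ≤ R`). [cite: Nolin2008, §4.1 (BBWW)] [cite: BollobasRiordan2006, Ch. 7 Lemma 5 p. 169] -/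
theorem adjFourArm_subset_adjFourArmCyc {r R : ℕ} (hr : 1 ≤ r) (hrR : r ≤ R) :
    adjFourArm r R ⊆ adjFourArmCyc r R := by
  rintro ω ⟨x, y, w, hw, hdisj, hjoin⟩
  refine ⟨x, y, w, hw, hdisj, fun hsep => ?_⟩
  rcases hjoin with ⟨u, hu, v, hv, hp⟩ | ⟨u, hu, v, hv, hp⟩
  · exact not_pathIn_open_of_hexSep hr hrR hw hdisj hsep u hu v hv hp
  · exact not_pathIn_closed_of_hexSep hr hrR hw hdisj hsep u hu v hv hp

/-! ### Arcs of the hexagons: two consecutive sides -/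

/-- `ρ^i (K, t)` lies on side `i` of `∂Λ_K` for `-K ≤ t ≤ 0`. [folklore] -/
theorem rot_mem_hexSide {K : ℕ} (i : ℕ) {t : ℤ} (ht : -(K : ℤ) ≤ t) (ht0 : t ≤ 0) :
    triRotIsoPow i ![(K : ℤ), t] ∈ hexSide K i :=
  mem_hexSide_iff.2 ⟨![(K : ℤ), t], ⟨by simp, by simpa using ht, by simpa using ht0⟩, rfl⟩

/-- **Along side `i` of `∂Λ_K`, inside the side**: from `ρ^i (K, t)` (`-K ≤ t ≤ 0`) to the last
corner `ρ^i (K, 0)`. [folklore] -/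
theorem pathIn_hexSide_up {K : ℕ} (i : ℕ) {t : ℤ} (ht : -(K : ℤ) ≤ t) (ht0 : t ≤ 0) :
    PathIn triGraph (hexSide K i) (triRotIsoPow i ![(K : ℤ), t]) (triRotIsoPow i ![(K : ℤ), 0]) := by
  suffices H : ∀ (m : ℕ) (s : ℤ), -(K : ℤ) ≤ s → s + m = 0 →
      PathIn triGraph (hexSide K i) (triRotIsoPow i ![(K : ℤ), s]) (triRotIsoPow i ![(K : ℤ), 0]) by
    exact H (-t).toNat t ht (by omega)
  intro m
  induction m with
  | zero =>
    intro s hs h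
    have : s = 0 := by omega
    subst this
    exact PathIn.refl (rot_mem_hexSide i (by omega) le_rfl)
  | succ m ih =>
    intro s hs h
    have hadj : triGraph.Adj (triRotIsoPow i ![(K : ℤ), s]) (triRotIsoPow i ![(K : ℤ), s + 1]) := by
      rw [rot_adj_iff, triGraph_adj_iff_coord]
      exact Or.inr (Or.inr (Or.inl ⟨by simp, by simp⟩))
    exact (PathIn.of_adj (rot_mem_hexSide i hs (by omega)) (rot_mem_hexSide i (by omega) (by omega))
      hadj).trans (ih (s + 1) (by omega) (by omega))

/-- The last corner of side `i` is the first corner of side `i + 1`: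
`ρ^i (K, 0) = ρ^{i+1} (K, -K)`. [folklore] -/
theorem rot_corner_succ (K i : ℕ) :
    triRotIsoPow i ![(K : ℤ), 0] = triRotIsoPow (i + 1) ![(K : ℤ), -(K : ℤ)] := by
  rw [triRotIsoPow_succ_apply', triRot60_corner]

/-- **The arc "sides `i` and `i + 1`" of `∂Λ_K`** (corners included). [cite: Nolin2008, §4.2 (landing areas on ∂S_N)] -/
def hexSector (K i : ℕ) : Set (Site 2) := hexSide K i ∪ hexSide K (i + 1)

/-- Sites of an arc have graph norm `K`. [folklore] -/
theorem triNorm_of_mem_hexSector {K i : ℕ} {z : Site 2} (hz : z ∈ hexSector K i) : triNorm z = K := by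
  rcases hz with hz | hz <;> exact triNorm_of_mem_hexSide hz

/-- **The arcs are connected**: every site of `hexSector K i` is joined inside the arc to its hub,
the last corner `ρ^{i+1} (K, 0)` of side `i + 1`. [folklore] -/
theorem pathIn_hexSector_to_hub {K i : ℕ} {z : Site 2} (hz : z ∈ hexSector K i) :
    PathIn triGraph (hexSector K i) z (triRotIsoPow (i + 1) ![(K : ℤ), 0]) := by
  have side : ∀ (a : ℕ) (v : Site 2), v ∈ hexSide K a →
      PathIn triGraph (hexSide K a) v (triRotIsoPow a ![(K : ℤ), 0]) := by
    intro a v hv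
    obtain ⟨s, ⟨h0, h1, h2⟩, rfl⟩ := mem_hexSide_iff.1 hv
    have hs : s = ![(K : ℤ), s 1] := by
      ext j; fin_cases j
      · simpa using h0
      · simp
    rw [hs]
    exact pathIn_hexSide_up a h1 h2
  rcases hz with hz | hz
  · have h1 := (side i z hz).mono (subset_union_left (t := hexSide K (i + 1)))
    rw [rot_corner_succ] at h1
    exact h1.trans ((pathIn_hexSide_up (i + 1) le_rfl (by omega)).mono subset_union_right)
  · exact (side (i + 1) z hz).mono subset_union_right

/-- **The arcs "sides `0, 1`" and "sides `3, 4`" of `∂Λ_K` are disjoint** (`K ≥ 1`). [folklore] -/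
theorem disjoint_hexSector_zero_three {K : ℕ} (hK : 1 ≤ K) : Disjoint (hexSector K 0) (hexSector K 3) := by
  refine Set.disjoint_left.2 fun z hz hz' => ?_
  rcases hz with hz | hz <;> rcases hz' with hz' | hz'
  · have h1 := mem_hexSide_zero.1 hz; have h2 := coord_of_mem_hexSide_three hz'; omega
  · have h1 := mem_hexSide_zero.1 hz; have h2 := coord_of_mem_hexSide_four hz'; omega
  · have h1 := coord_of_mem_hexSide_one hz; have h2 := coord_of_mem_hexSide_three hz'; omega
  · have h1 := coord_of_mem_hexSide_one hz; have h2 := coord_of_mem_hexSide_four hz'; omega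

/-- **The inward step along a side**: a site of side `i` of `∂Λ_{K+1}` has a neighbour on side `i`
of `∂Λ_K` (from `ρ^i (K+1, t)` to `ρ^i (K, t)` or, at the first corner, `ρ^i (K, t+1)`). [folklore] -/
theorem exists_adj_mem_hexSide_pred {K i : ℕ} {z : Site 2} (hz : z ∈ hexSide (K + 1) i) :
    ∃ z' : Site 2, triGraph.Adj z z' ∧ z' ∈ hexSide K i := by
  obtain ⟨s, ⟨h0, h1, h2⟩, rfl⟩ := mem_hexSide_iff.1 hz
  push_cast at h0 h1
  by_cases hc : s 1 = -((K : ℤ) + 1)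
  · refine ⟨triRotIsoPow i ![(K : ℤ), s 1 + 1], ?_,
      rot_mem_hexSide (K := K) i (t := s 1 + 1) (by omega) (by omega)⟩
    rw [rot_adj_iff, triGraph_adj_iff_coord]
    simp only [Matrix.cons_val_zero, Matrix.cons_val_one, true_and, and_true]
    omega
  · refine ⟨triRotIsoPow i ![(K : ℤ), s 1], ?_, rot_mem_hexSide (K := K) i (t := s 1) (by omega) h2⟩
    rw [rot_adj_iff, triGraph_adj_iff_coord]
    simp only [Matrix.cons_val_zero, Matrix.cons_val_one, and_true]
    omega

/-- The inward step along an arc. [folklore] -/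
theorem exists_adj_mem_hexSector_pred {K i : ℕ} {z : Site 2} (hz : z ∈ hexSector (K + 1) i) :
    ∃ z' : Site 2, triGraph.Adj z z' ∧ z' ∈ hexSector K i := by
  rcases hz with hz | hz
  · obtain ⟨z', h, h'⟩ := exists_adj_mem_hexSide_pred hz; exact ⟨z', h, Or.inl h'⟩
  · obtain ⟨z', h, h'⟩ := exists_adj_mem_hexSide_pred hz; exact ⟨z', h, Or.inr h'⟩

/-! ### Inner landing types the outer extremities -/

section InnerLanded

variable {K R : ℕ} {ω : SiteConfig (Site 2)} {x y : Fin 4 → Site 2}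
  {w : ∀ j, triGraph.Walk (x j) (y j)}

/-- **Arms landed on the inner arcs "sides `0, 1`" (open) and "sides `3, 4`" (closed) of
`∂Λ_{K+1}` have cyclically adjacent outer extremities** (`1 ≤ K`, `K + 1 ≤ R`). Both pairs are
joined through the hole `Λ_K`, the open pair inside the arc "sides `0, 1`" of `∂Λ_K`, the closed
pair inside the arc "sides `3, 4`" of `∂Λ_K` (`pathIn_hexSector_to_hub`, the two arcs being
disjoint); with the arms this gives a path of `Λ_R ∩ B` between the open outer extremities and a
path of `Λ_R ∖ B` between the closed ones, `B` = open arms ∪ first arc, and `not_hexSep_of_paths`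
applies. Only the disjointness of the four arms is used (no colours, no first-passage
normalisation). [cite: Nolin2008, §4.2 (arXiv 0711.4948, Def. 7: landing sequences I on ∂S_n) and §6.2, proof of Thm. 27 ("by quasi-multiplicativity", the inner annulus)] [cite: BollobasRiordan2006, Ch. 7 Lemma 5 p. 169] -/
theorem not_hexSep_of_innerLanded (hK : 1 ≤ K) (hKR : K + 1 ≤ R)
    (hw : ∀ j, x j ∈ triSphere (K + 1) ∧ y j ∈ triSphere R ∧ (w j).IsPath ∧
      (∀ v ∈ (w j).support, v ∈ (↑(triBall R) : Set (Site 2)) \ ↑(triBall (K + 1)) ∨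
        v ∈ triSphere (K + 1)) ∧
      IsColouredPath ω (![true, false, true, false] j) (w j))
    (hdisj : Pairwise fun i j => Disjoint (w i).support.toFinset (w j).support.toFinset)
    (hx0 : x 0 ∈ hexSector (K + 1) 0) (hx2 : x 2 ∈ hexSector (K + 1) 0)
    (hx1 : x 1 ∈ hexSector (K + 1) 3) (hx3 : x 3 ∈ hexSector (K + 1) 3) :
    ¬ HexSep (hexPos R (y 1)) (hexPos R (y 3)) (hexPos R (y 0)) (hexPos R (y 2)) := by
  classical
  have hR : 1 ≤ R := by omega
  have hb := arm_support_bounds hKR hw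
  have hyn : ∀ j, triNorm (y j) = R := fun j => mem_triSphere_iff.1 (hw j).2.1
  have hdj : ∀ {i j : Fin 4}, i ≠ j → ∀ z ∈ (w i).support, z ∉ (w j).support := fun hij z hz hz' =>
    Finset.disjoint_left.1 (hdisj hij) (List.mem_toFinset.2 hz) (List.mem_toFinset.2 hz')
  have hball : ∀ {z : Site 2}, triNorm z ≤ R → z ∈ (↑(triBall R) : Set (Site 2)) := fun hz =>
    Finset.mem_coe.2 (mem_triBall_iff.2 hz)
  -- the class `B` = open arms ∪ the arc "sides 0, 1" of `∂Λ_K`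
  set B : Set (Site 2) := {z | z ∈ (w 0).support ∨ z ∈ (w 2).support ∨ z ∈ hexSector K 0} with hB
  have hsecK : ∀ {z : Site 2} (i : ℕ), z ∈ hexSector K i → triNorm z = K := fun i hz =>
    triNorm_of_mem_hexSector hz
  -- the open pair through the first arc
  obtain ⟨a₀, hadj₀, ha₀⟩ := exists_adj_mem_hexSector_pred hx0
  obtain ⟨a₂, hadj₂, ha₂⟩ := exists_adj_mem_hexSector_pred hx2
  have harc0 : PathIn triGraph ((↑(triBall R) : Set (Site 2)) ∩ B) a₀ a₂ :=
    ((pathIn_hexSector_to_hub ha₀).trans (pathIn_hexSector_to_hub ha₂).symm).mono fun z hz =>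
      ⟨hball (by rw [hsecK 0 hz]; omega), Or.inr (Or.inr hz)⟩
  have hw0B : ∀ z ∈ (w 0).support, z ∈ (↑(triBall R) : Set (Site 2)) ∩ B := fun z hz =>
    ⟨hball (hb 0 z hz).2, Or.inl hz⟩
  have hw2B : ∀ z ∈ (w 2).support, z ∈ (↑(triBall R) : Set (Site 2)) ∩ B := fun z hz =>
    ⟨hball (hb 2 z hz).2, Or.inr (Or.inl hz)⟩
  have hP : PathIn triGraph ((↑(triBall R) : Set (Site 2)) ∩ B) (y 0) (y 2) :=
    ((((PathIn.of_walk (w 0) hw0B).symm.tail hadj₀ harc0.left_mem).trans harc0).trans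
      (PathIn.of_adj harc0.right_mem (hw2B _ (w 2).start_mem_support) hadj₂.symm)).trans
      (PathIn.of_walk (w 2) hw2B)
  -- the closed pair through the second arc, off `B`
  obtain ⟨a₁, hadj₁, ha₁⟩ := exists_adj_mem_hexSector_pred hx1
  obtain ⟨a₃, hadj₃, ha₃⟩ := exists_adj_mem_hexSector_pred hx3
  have hsec3 : ∀ z ∈ hexSector K 3, z ∈ (↑(triBall R) : Set (Site 2)) ∩ Bᶜ := by
    intro z hz
    have hzK := hsecK 3 hz
    refine ⟨hball (by omega), fun h => h.elim (fun h => ?_) fun h => h.elim (fun h => ?_) fun h => ?_⟩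
    · have := (hb 0 z h).1; push_cast at this; omega
    · have := (hb 2 z h).1; push_cast at this; omega
    · exact Set.disjoint_left.1 (disjoint_hexSector_zero_three hK) h hz
  have harc3 : PathIn triGraph ((↑(triBall R) : Set (Site 2)) ∩ Bᶜ) a₁ a₃ :=
    ((pathIn_hexSector_to_hub ha₁).trans (pathIn_hexSector_to_hub ha₃).symm).mono hsec3
  have hoffB : ∀ (j : Fin 4), j = 1 ∨ j = 3 → ∀ z ∈ (w j).support,
      z ∈ (↑(triBall R) : Set (Site 2)) ∩ Bᶜ := by
    intro j hj z hz
    refine ⟨hball (hb j z hz).2, fun h => h.elim (fun h => ?_) fun h => h.elim (fun h => ?_) fun h => ?_⟩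
    · rcases hj with rfl | rfl
      · exact hdj (by decide) z hz h
      · exact hdj (by decide) z hz h
    · rcases hj with rfl | rfl
      · exact hdj (by decide) z hz h
      · exact hdj (by decide) z hz h
    · have h1 := (hb j z hz).1; have h2 := hsecK 0 h; push_cast at h1; omega
  have hQ : PathIn triGraph ((↑(triBall R) : Set (Site 2)) ∩ Bᶜ) (y 1) (y 3) :=
    ((((PathIn.of_walk (w 1) (hoffB 1 (Or.inl rfl))).symm.tail hadj₁ harc3.left_mem).trans
      harc3).trans (PathIn.of_adj harc3.right_mem (hoffB 3 (Or.inr rfl) _ (w 3).start_mem_support)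
      hadj₃.symm)).trans (PathIn.of_walk (w 3) (hoffB 3 (Or.inr rfl)))
  exact not_hexSep_of_paths hR B (hyn 0) (hyn 1) (hyn 2) (hyn 3) hP hQ

/-- **Inner-landed four-arm families are cyclically adjacent**: a family of `armEvent`-arms across
`{K + 1 ≤ |·|_𝕋 ≤ R}` (`1 ≤ K`), open, closed, open, closed, whose open arms start on the arc
"sides `0, 1`" of `∂Λ_{K+1}` and whose closed arms start on the arc "sides `3, 4`", puts `ω` in
`adjFourArmCyc (K + 1) R`. [cite: Nolin2008, §4.1–4.2 (arXiv 0711.4948: A_{j,σ} and the landing sequences)] -/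
theorem mem_adjFourArmCyc_of_innerLanded (hK : 1 ≤ K) (hKR : K + 1 ≤ R)
    (hw : ∀ j, x j ∈ triSphere (K + 1) ∧ y j ∈ triSphere R ∧ (w j).IsPath ∧
      (∀ v ∈ (w j).support, v ∈ (↑(triBall R) : Set (Site 2)) \ ↑(triBall (K + 1)) ∨
        v ∈ triSphere (K + 1)) ∧
      IsColouredPath ω (![true, false, true, false] j) (w j))
    (hdisj : Pairwise fun i j => Disjoint (w i).support.toFinset (w j).support.toFinset)
    (hx0 : x 0 ∈ hexSector (K + 1) 0) (hx2 : x 2 ∈ hexSector (K + 1) 0)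
    (hx1 : x 1 ∈ hexSector (K + 1) 3) (hx3 : x 3 ∈ hexSector (K + 1) 3) :
    ω ∈ adjFourArmCyc (K + 1) R :=
  ⟨x, y, w, hw, hdisj, not_hexSep_of_innerLanded hK hKR hw hdisj hx0 hx2 hx1 hx3⟩

end InnerLanded

/-! ### Outer landing types the outer extremities (positions only) -/

/-- **Perimeter coordinates of a side**: a site of side `i ≤ 4` of `∂Λ_R` (`R ≥ 1`, corners
included) has `i R ≤ hexPos ≤ (i + 1) R`. [folklore] -/
theorem hexPos_bounds_of_mem_hexSide {R i : ℕ} (hR : 1 ≤ R) (hi : i ≤ 4) {z : Site 2}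
    (hz : z ∈ hexSide R i) : (i : ℤ) * R ≤ hexPos R z ∧ hexPos R z ≤ (i + 1) * R := by
  obtain ⟨s, ⟨h0, h1, h2⟩, rfl⟩ := mem_hexSide_iff.1 hz
  have hs : s = ![(R : ℤ), s 1] := by
    ext j; fin_cases j
    · simpa using h0
    · simp
  rcases lt_or_eq_of_le h2 with hlt | heq
  · rw [hs, hexPos_rot_side0 (by omega) h1 hlt]
    constructor <;> nlinarith
  · rw [hs, heq, rot_corner_succ, hexPos_rot_side0 (by omega) le_rfl (by omega)]
    push_cast
    constructor <;> nlinarith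

/-- Perimeter coordinates of the two arcs: `[0, 2R]` for "sides `0, 1`", `[3R, 5R]` for
"sides `3, 4`" (`R ≥ 1`). [folklore] -/
theorem hexPos_bounds_of_mem_hexSector {R : ℕ} (hR : 1 ≤ R) {z : Site 2} :
    (z ∈ hexSector R 0 → 0 ≤ hexPos R z ∧ hexPos R z ≤ 2 * R) ∧
      (z ∈ hexSector R 3 → 3 * (R : ℤ) ≤ hexPos R z ∧ hexPos R z ≤ 5 * R) := by
  constructor
  · rintro (hz | hz)
    · have := hexPos_bounds_of_mem_hexSide hR (by norm_num) hz; push_cast at this; omega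
    · have := hexPos_bounds_of_mem_hexSide hR (by norm_num) hz; push_cast at this; omega
  · rintro (hz | hz)
    · have := hexPos_bounds_of_mem_hexSide hR (by norm_num) hz; push_cast at this; omega
    · have := hexPos_bounds_of_mem_hexSide hR (by norm_num) hz; push_cast at this; omega

/-- **Arms landed on the outer arcs "sides `0, 1`" (open) and "sides `3, 4`" (closed) of `∂Λ_R`
are cyclically adjacent** (positions of the perimeter coordinates only). [cite: Nolin2008, §4.2 (arXiv 0711.4948, Def. 7: landing sequences I' on ∂S_N)] -/
theorem not_hexSep_of_outerLanded {R : ℕ} (hR : 1 ≤ R) {y₀ y₁ y₂ y₃ : Site 2}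
    (hy0 : y₀ ∈ hexSector R 0) (hy2 : y₂ ∈ hexSector R 0) (hy1 : y₁ ∈ hexSector R 3)
    (hy3 : y₃ ∈ hexSector R 3) :
    ¬ HexSep (hexPos R y₁) (hexPos R y₃) (hexPos R y₀) (hexPos R y₂) := by
  have h0 := (hexPos_bounds_of_mem_hexSector hR).1 hy0
  have h2 := (hexPos_bounds_of_mem_hexSector hR).1 hy2
  have h1 := (hexPos_bounds_of_mem_hexSector hR).2 hy1
  have h3 := (hexPos_bounds_of_mem_hexSector hR).2 hy3
  unfold HexSep HexBtw; omega

/-- **Outer-landed four-arm families are cyclically adjacent.** [cite: Nolin2008, §4.1–4.2 (arXiv 0711.4948: A_{j,σ} and the landing sequences)] -/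
theorem mem_adjFourArmCyc_of_outerLanded {r R : ℕ} (hR : 1 ≤ R) {ω : SiteConfig (Site 2)}
    {x y : Fin 4 → Site 2} {w : ∀ j, triGraph.Walk (x j) (y j)}
    (hw : ∀ j, x j ∈ triSphere r ∧ y j ∈ triSphere R ∧ (w j).IsPath ∧
      (∀ v ∈ (w j).support, v ∈ (↑(triBall R) : Set (Site 2)) \ ↑(triBall r) ∨ v ∈ triSphere r) ∧
      IsColouredPath ω (![true, false, true, false] j) (w j))
    (hdisj : Pairwise fun i j => Disjoint (w i).support.toFinset (w j).support.toFinset)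
    (hy0 : y 0 ∈ hexSector R 0) (hy2 : y 2 ∈ hexSector R 0) (hy1 : y 1 ∈ hexSector R 3)
    (hy3 : y 3 ∈ hexSector R 3) :
    ω ∈ adjFourArmCyc r R :=
  ⟨x, y, w, hw, hdisj, not_hexSep_of_outerLanded hR hy0 hy2 hy1 hy3⟩

end Literature.Probability.Percolation
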